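import Literature.Algebra.EuclideanLattices.RegevQuantumPartLaw
import HarnessLib

/-!
# Regev 2009, Lemma 3.14: the law of the quantum part with a NEAR-IDEAL classical stage

Topic `Literature/Algebra/EuclideanLattices`, grouping namespace `Regev2009.QPart`; a short sequel of
`RegevQuantumPartLaw.lean` (`QPart.law_bound`, `law_bound_of_basis`: the measured law of the machine
`M_F · M_cl · (Gaussian stage)` is within `2(ε₁ + ε_F + 8C) + 2η₀ + 9·2⁻ⁿ` of `D_{L,1/√2}` when the
classical stage `M_cl` IS the ideal basis map along `κc`). In Regev's sampler (J. ACM 56 (2009), art. 34,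
proof of Lemma 3.14) the classical stage calls the `CVP` procedure of Lemma 3.4 twice, and that procedure
is a bounded-error quantum subroutine, not an oracle gate: the real stage `M_re` is a unitary that agrees
with the ideal `M_cl` only APPROXIMATELY, and only on the state actually fed to it — the box Gaussian
`Φ₀ = Z⁻¹ Σ_{x ∈ Box} ρ(x) |lab₀ x⟩` (Bennett–Bernstein–Brassard–Vazirani 1997, Thm. 3.3: errors are
measured along the ideal run). This file records the one-line reduction of that situation to `law_bound`:

* **`QPart.law_bound_near`**, **`law_bound_of_basis_near`** — if `M_re` is unitary and
  `‖M_re Φ₀ − M_cl Φ₀‖₂ ≤ ε_S`, the law measured after `M_F · M_re` obeys the bound of `law_bound` with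
  `ε₁ + ε_S` in place of `ε₁`. Proof: the unit vector `Ψ′ = M_cl⋆ M_re Ψ_GR` has `M_cl Ψ′ = M_re Ψ_GR` and
  `‖Ψ′ − Φ₀‖ = ‖M_re Ψ_GR − M_cl Φ₀‖ ≤ ε₁ + ε_S`, so `law_bound` applies to `Ψ′` verbatim.

The substitution bound `ε_S ≤ 2√(Σ_q ε(q) w₁(q)) + 2√(Σ_q ε(q) w₂(q))` for the five-factor stage with
tidy subroutine blocks is `TidyBlockFn.l2Norm_stage_tidy_sub_le` (`QuantumComplexity/TidyBlockFnPlaced.lean`).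
Everything is proved; no named fact is introduced.

## References

* O. Regev, *On lattices, learning with errors, random linear codes, and cryptography*, J. ACM 56
  (2009), art. 34; author's version arXiv:2401.03703: Lemma 3.14 (proof), Lemma 3.3 (proof: the oracle
  is the procedure of Lemma 3.4) [Regev2009].
* C. H. Bennett, E. Bernstein, G. Brassard, U. Vazirani, *Strengths and weaknesses of quantum
  computing*, SIAM J. Comput. 26 (1997) 1510–1523, Thm. 3.1 (close states give close laws), Thm. 3.3
  (hybrid argument) [BennettBernsteinBrassardVazirani1997].
* M. A. Nielsen, I. L. Chuang, *Quantum Computation and Quantum Information*, CUP 2010, §2.1.6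
  (unitaries preserve norms) [NielsenChuang2010].
-/

noncomputable section

open Module Metric Finset _root_.Matrix
open scoped Real InnerProductSpace ENNReal Kronecker

namespace Literature.Algebra.EuclideanLattices

namespace Regev2009

namespace QPart

open Literature.Computability.Cryptography Literature.Computability.QuantumComplexity
  Literature.Computability.QuantumComplexity.QState Literature.Computability.QuantumComplexity.QFTQubits

variable {V : Type*} {W m κ : ℕ}
variable {S : Fin m → (Fin κ ↪ Fin W)} {base : V → QReg W} {enc : ZMod (2 ^ κ) → Fin κ → Bool}
  {Box : Finset V} {yOf : V → V} {sOf : V → Fin m → ZMod (2 ^ κ)} {Good : V → Prop}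
  {lab₀ : V → QReg W} {κc : QReg W → QReg W}
variable [NormedAddCommGroup V] [InnerProductSpace ℝ V] [DecidableEq V]
variable {Λ : Submodule ℤ V} {e : Basis (Fin m) ℤ Λ}

omit [NormedAddCommGroup V] [InnerProductSpace ℝ V] [DecidableEq V] in
/-- **The pull-back trick.** For unitaries `M_cl`, `M_re` and a unit vector `Ψ`, the vector
`Ψ′ = M_cl⋆ M_re Ψ` is a unit vector with `M_cl Ψ′ = M_re Ψ`, and its distance to any `Φ₀` is at most
`‖M_re Ψ − M_re Φ₀‖ + ‖M_re Φ₀ − M_cl Φ₀‖`. [cite: NielsenChuang2010, §2.1.6] [cite: BennettBernsteinBrassardVazirani1997, Thm. 3.3 (proof)] -/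
theorem pullback_near {Mcl Mre : Matrix (QReg W) (QReg W) ℂ} (hMclU : Mcl ∈ Matrix.unitaryGroup (QReg W) ℂ)
    (hMreU : Mre ∈ Matrix.unitaryGroup (QReg W) ℂ) {Ψ : QReg W → ℂ} (hΨ : l2Norm Ψ = 1) (Φ₀ : QReg W → ℂ)
    {ε₁ εS : ℝ} (hε₁ : l2Norm (Ψ - Φ₀) ≤ ε₁) (hεS : l2Norm (Mre *ᵥ Φ₀ - Mcl *ᵥ Φ₀) ≤ εS) :
    Mcl *ᵥ (star Mcl *ᵥ (Mre *ᵥ Ψ)) = Mre *ᵥ Ψ ∧ l2Norm (star Mcl *ᵥ (Mre *ᵥ Ψ)) = 1 ∧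
      l2Norm (star Mcl *ᵥ (Mre *ᵥ Ψ) - Φ₀) ≤ ε₁ + εS := by
  have hMclS : star Mcl ∈ Matrix.unitaryGroup (QReg W) ℂ := Unitary.star_mem hMclU
  have hfix : Mcl *ᵥ (star Mcl *ᵥ (Mre *ᵥ Ψ)) = Mre *ᵥ Ψ := by
    rw [Matrix.mulVec_mulVec, Matrix.mem_unitaryGroup_iff.1 hMclU, Matrix.one_mulVec]
  refine ⟨hfix, ?_, ?_⟩
  · rw [l2Norm_mulVec_of_mem_unitaryGroup hMclS, l2Norm_mulVec_of_mem_unitaryGroup hMreU, hΨ]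
  · have h1 : l2Norm (star Mcl *ᵥ (Mre *ᵥ Ψ) - Φ₀) = l2Norm (Mre *ᵥ Ψ - Mcl *ᵥ Φ₀) := by
      rw [← l2Norm_mulVec_of_mem_unitaryGroup hMclU (star Mcl *ᵥ (Mre *ᵥ Ψ) - Φ₀), Matrix.mulVec_sub, hfix]
    rw [h1]
    calc l2Norm (Mre *ᵥ Ψ - Mcl *ᵥ Φ₀)
        ≤ l2Norm (Mre *ᵥ Ψ - Mre *ᵥ Φ₀) + l2Norm (Mre *ᵥ Φ₀ - Mcl *ᵥ Φ₀) := l2Norm_sub_le _ _ _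
      _ ≤ ε₁ + εS := add_le_add (by rw [← Matrix.mulVec_sub, l2Norm_mulVec_of_mem_unitaryGroup hMreU]; exact hε₁) hεS

open Classical in
/-- **Regev 2009, Lemma 3.14, machine form with a near-ideal classical stage.** As `law_bound`, but the
classical stage actually run is a unitary `M_re` with `‖M_re Φ₀ − M_cl Φ₀‖₂ ≤ ε_S` on the box Gaussian
`Φ₀ = Z⁻¹ Σ_{x ∈ Box} ρ(x)|lab₀ x⟩`, `M_cl` the ideal basis map along `κc`: for every event `A`,

  `|Pr_{z ∼ |M_F M_re Ψ_GR|²}[dec (readS z) ∈ A] − D_{L,1/√2}(A)| ≤ 2(ε₁ + ε_S + ε_F + 8C) + 2η₀ + 9·2⁻ⁿ`.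

[cite: Regev2009, Lemma 3.14 (proof)] [cite: BennettBernsteinBrassardVazirani1997, Thm. 3.1, Thm. 3.3] -/
theorem law_bound_near [FiniteDimensional ℝ V] [MeasurableSpace V] [BorelSpace V] [Nontrivial V]
    {Λ : Submodule ℤ V} [DiscreteTopology Λ] [IsZLattice ℝ Λ] {e : Basis (Fin m) ℤ Λ} [NeZero (2 ^ κ : ℕ)]
    [DecidablePred Good]
    (hH : FibreHyps Λ e (2 ^ κ) Box yOf sOf Good) (hR : RegHyps S base enc Box yOf sOf Good lab₀ κc) (hne : Box.Nonempty)
    -- lattice hypotheses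
    (hsvΛ : ∀ z ∈ scaledLattice Λ (2 ^ κ), ‖z‖ < 2 * Real.sqrt (finrank ℝ V) → z = 0)
    (hsv : ShortVectorsTrivial Λ e (2 ^ κ)) {dec : (Fin m → ZMod (2 ^ κ)) → V} (hdec : IsDecoder Λ e (2 ^ κ) dec)
    {B Y C : ℝ} (hBox : ∀ x ∈ Box, BoxCoversShort Λ Box (yOf x)) (hY : ∀ x ∈ Box, ‖yOf x‖ ≤ Y)
    (hB : ∀ x ∈ Box, ∀ x' ∈ Box, ‖x - yOf x'‖ ≤ B) (hδ : π * (2 * Real.sqrt (finrank ℝ V) * Y + Y ^ 2) < 1)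
    (hC : Real.exp (2 * π * B * Y) * (2⁻¹ : ℝ) ^ finrank ℝ V ≤
      C * ((1 - π * (2 * Real.sqrt (finrank ℝ V) * Y + Y ^ 2)) * (1 - banaConst ^ finrank ℝ V) * (1 - (4⁻¹ : ℝ) ^ finrank ℝ V)))
    (hC2 : C ≤ 1 / 2) (hC0 : 0 ≤ C)
    -- machine hypotheses
    {ΨGR : QReg W → ℂ} (hΨGR : l2Norm ΨGR = 1) {ε₁ : ℝ}
    (hε₁ : l2Norm (ΨGR - embed Box (fun x => (((gaussianFunction 1 x / zBox Box : ℝ)) : ℂ)) lab₀) ≤ ε₁)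
    {Mcl : Matrix (QReg W) (QReg W) ℂ} (hMcl : IsBasisMap Mcl κc) (hMclU : Mcl ∈ Matrix.unitaryGroup (QReg W) ℂ)
    {Mre : Matrix (QReg W) (QReg W) ℂ} (hMreU : Mre ∈ Matrix.unitaryGroup (QReg W) ℂ) {εS : ℝ}
    (hεS : l2Norm (Mre *ᵥ embed Box (fun x => (((gaussianFunction 1 x / zBox Box : ℝ)) : ℂ)) lab₀ -
      Mcl *ᵥ embed Box (fun x => (((gaussianFunction 1 x / zBox Box : ℝ)) : ℂ)) lab₀) ≤ εS)
    {MF : Matrix (QReg W) (QReg W) ℂ} (hMFU : MF ∈ Matrix.unitaryGroup (QReg W) ℂ) {PF : Set (QReg W)} {εF : ℝ}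
    (hMF : ImplOn PF MF (multiQFT S) εF) (hPF : ∀ x ∈ Box, κc (lab₀ x) ∈ PF)
    (A : Set V) :
    |∑ z ∈ univ.filter (fun z => dec (readS S z) ∈ A), ‖(MF *ᵥ (Mre *ᵥ ΨGR)) z‖ ^ 2 -
        ((discreteGaussian (primalLattice Λ e (2 ^ κ)) (Real.sqrt 2)⁻¹ 0).toOuterMeasure
          {x : primalLattice Λ e (2 ^ κ) | (x : V) ∈ A}).toReal| ≤
      2 * (ε₁ + εS + εF + 8 * C) +
        2 * (Real.sqrt (2 * (π * (2 * Real.sqrt (finrank ℝ V) * Y + Y ^ 2) + banaConst ^ finrank ℝ V + 4⁻¹ ^ finrank ℝ V)) +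
          2 * (2⁻¹ : ℝ) ^ finrank ℝ V) + 9 * (2⁻¹ : ℝ) ^ finrank ℝ V := by
  obtain ⟨hfix, hΨ'1, hε'⟩ := pullback_near hMclU hMreU hΨGR _ hε₁ hεS
  have h := law_bound hH hR hne hsvΛ hsv hdec hBox hY hB hδ hC hC2 hC0 hΨ'1 hε' hMcl hMclU hMFU hMF hPF A
  rwa [hfix] at h

open Classical in
/-- **The same from the data `(L, (Lⱼ), R = 2^κ)`** (`law_bound_of_basis` with a near-ideal classical
stage): the conclusion on `D_{L,1/√2}` with `ε₁ + ε_S` in place of `ε₁`.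
[cite: Regev2009, Lemma 3.14 (proof)] [cite: BennettBernsteinBrassardVazirani1997, Thm. 3.1, Thm. 3.3] -/
theorem law_bound_of_basis_near [FiniteDimensional ℝ V] [MeasurableSpace V] [BorelSpace V] [Nontrivial V]
    (L : Submodule ℤ V) [DiscreteTopology L] [IsZLattice ℝ L] (bL : Basis (Fin m) ℤ L) [NeZero (2 ^ κ : ℕ)] [DecidablePred Good]
    (hH : FibreHyps (dualOver (2 ^ κ) L bL) (dualOverZBasis (2 ^ κ) L bL) (2 ^ κ) Box yOf sOf Good)
    (hR : RegHyps S base enc Box yOf sOf Good lab₀ κc) (hne : Box.Nonempty)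
    -- lattice hypotheses
    (hsvΛ : ∀ z ∈ scaledLattice (dualOver (2 ^ κ) L bL) (2 ^ κ), ‖z‖ < 2 * Real.sqrt (finrank ℝ V) → z = 0)
    (hL : ∀ x ∈ L, ‖((2 ^ κ : ℕ) : ℝ) • x‖ < 2 * Real.sqrt (finrank ℝ V) → x = 0)
    {dec : (Fin m → ZMod (2 ^ κ)) → V}
    (hdec : ∀ t : Fin m → ZMod (2 ^ κ), ∀ x ∈ L,
      ‖∑ j, ((t j).val : ℝ) • ((bL j : L) : V) + ((2 ^ κ : ℕ) : ℝ) • x‖ < Real.sqrt (finrank ℝ V) →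
        dec t = ∑ j, ((t j).val : ℝ) • ((bL j : L) : V) + ((2 ^ κ : ℕ) : ℝ) • x)
    {B Y C : ℝ} (hBox : ∀ x ∈ Box, BoxCoversShort (dualOver (2 ^ κ) L bL) Box (yOf x)) (hY : ∀ x ∈ Box, ‖yOf x‖ ≤ Y)
    (hB : ∀ x ∈ Box, ∀ x' ∈ Box, ‖x - yOf x'‖ ≤ B) (hδ : π * (2 * Real.sqrt (finrank ℝ V) * Y + Y ^ 2) < 1)
    (hC : Real.exp (2 * π * B * Y) * (2⁻¹ : ℝ) ^ finrank ℝ V ≤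
      C * ((1 - π * (2 * Real.sqrt (finrank ℝ V) * Y + Y ^ 2)) * (1 - banaConst ^ finrank ℝ V) * (1 - (4⁻¹ : ℝ) ^ finrank ℝ V)))
    (hC2 : C ≤ 1 / 2) (hC0 : 0 ≤ C)
    -- machine hypotheses
    {ΨGR : QReg W → ℂ} (hΨGR : l2Norm ΨGR = 1) {ε₁ : ℝ}
    (hε₁ : l2Norm (ΨGR - embed Box (fun x => (((gaussianFunction 1 x / zBox Box : ℝ)) : ℂ)) lab₀) ≤ ε₁)
    {Mcl : Matrix (QReg W) (QReg W) ℂ} (hMcl : IsBasisMap Mcl κc) (hMclU : Mcl ∈ Matrix.unitaryGroup (QReg W) ℂ)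
    {Mre : Matrix (QReg W) (QReg W) ℂ} (hMreU : Mre ∈ Matrix.unitaryGroup (QReg W) ℂ) {εS : ℝ}
    (hεS : l2Norm (Mre *ᵥ embed Box (fun x => (((gaussianFunction 1 x / zBox Box : ℝ)) : ℂ)) lab₀ -
      Mcl *ᵥ embed Box (fun x => (((gaussianFunction 1 x / zBox Box : ℝ)) : ℂ)) lab₀) ≤ εS)
    {MF : Matrix (QReg W) (QReg W) ℂ} (hMFU : MF ∈ Matrix.unitaryGroup (QReg W) ℂ) {PF : Set (QReg W)} {εF : ℝ}
    (hMF : ImplOn PF MF (multiQFT S) εF) (hPF : ∀ x ∈ Box, κc (lab₀ x) ∈ PF)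
    (A : Set V) :
    |∑ z ∈ univ.filter (fun z => dec (readS S z) ∈ A), ‖(MF *ᵥ (Mre *ᵥ ΨGR)) z‖ ^ 2 -
        ((discreteGaussian L (Real.sqrt 2)⁻¹ 0).toOuterMeasure {x : L | (x : V) ∈ A}).toReal| ≤
      2 * (ε₁ + εS + εF + 8 * C) +
        2 * (Real.sqrt (2 * (π * (2 * Real.sqrt (finrank ℝ V) * Y + Y ^ 2) + banaConst ^ finrank ℝ V + 4⁻¹ ^ finrank ℝ V)) +
          2 * (2⁻¹ : ℝ) ^ finrank ℝ V) + 9 * (2⁻¹ : ℝ) ^ finrank ℝ V := by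
  obtain ⟨hfix, hΨ'1, hε'⟩ := pullback_near hMclU hMreU hΨGR _ hε₁ hεS
  have h := law_bound_of_basis L bL hH hR hne hsvΛ hL hdec hBox hY hB hδ hC hC2 hC0 hΨ'1 hε' hMcl hMclU hMFU hMF hPF A
  rwa [hfix] at h

end QPart

end Regev2009

end Literature.Algebra.EuclideanLattices

end
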